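import Mathlib.Analysis.Fourier.Inversion
import Mathlib.MeasureTheory.Measure.CharacteristicFunction.Basic
import Mathlib.MeasureTheory.Measure.HasOuterApproxClosed
import Mathlib.MeasureTheory.Measure.Haar.NormedSpace
import HarnessLib

/-!
# Fourier inversion for finite measures, I: Gaussian smoothing and the candidate density

Let `μ` be a finite Borel measure on a finite-dimensional real inner product space `V` (Lebesgue
measure `volume`), with Fourier transform `μ̂(w) = ∫ e^{−2πi⟪x,w⟫} dμ(x)` (`fourierMeasure`; in
terms of Mathlib's characteristic function, `μ̂(w) = charFun μ (−2πw)`,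
`fourierMeasure_eq_charFun`). This file and its sequel `CharFunInversion.lean` prove the
classical inversion theorem for measures — *if `μ̂` (equivalently `charFun μ`) is
Lebesgue-integrable, then `μ` has the continuous bounded density `f_μ = 𝓕⁻ μ̂`* (e.g. Durrett,
*Probability: Theory and Examples*, Thm. 3.3.14 for `d = 1`; Feller II, XV.3) — which Mathlib
(at the pinned commit) has only for functions (`MeasureTheory.Integrable.fourierInv_fourier_eq`).
The proof is the Gaussian-smoothing argument of Mathlib's `Mathlib.Analysis.Fourier.Inversion`,
run with the measure `μ` in place of `f dx`:

* `gaussKernel c` — the heat kernel `K_c(y) = (πc)^{d/2} e^{−π²c‖y‖²}` (`∫ K_c = 1`), and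
  `gaussSmooth μ c v = ∫ K_c(v − x) dμ(x)` — the density of `μ` smoothed at scale `c^{-1/2}`;
  `∫ g_c = μ(V)` (`integral_gaussSmooth`, Tonelli).
* `integral_cexp_mul_fourierMeasure` — the key identity
  `∫ e^{−‖w‖²/c + 2πi⟪v,w⟫} μ̂(w) dw = g_c(v)` (Mathlib's multiplication formula
  `VectorFourier.integral_fourierIntegral_smul_eq_flip` with the constant function `1` against
  `μ`, and the Fourier transform of the Gaussian `fourier_gaussian_innerProductSpace'`).
* `tendsto_gaussSmooth` — hence `g_c(v) → (𝓕⁻ μ̂)(v)` as `c → ∞` when `μ̂ ∈ L¹` (dominated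
  convergence, `Real.tendsto_integral_cexp_sq_smul`); so `𝓕⁻ μ̂` is real and `≥ 0`, and we set
  `fourierDensity μ v = Re (𝓕⁻ μ̂)(v)` (continuous, `0 ≤ f_μ ≤ ‖μ̂‖₁`).
* `lintegral_fourierDensity_le`, `integrable_fourierDensity` — Fatou: `∫ f_μ ≤ μ(V)`.

The identification `μ = f_μ · volume` is `eq_withDensity_fourierDensity` in the sequel.

## References

* R. Durrett, *Probability: Theory and Examples* (4th ed.), Thm. 3.3.14 (inversion formula for
  integrable characteristic functions, `d = 1`); W. Feller, *An Introduction to Probability Theory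
  and its Applications* II, XV.3. The `d`-dimensional statement and this proof are folklore.
-/

noncomputable section

open _root_.MeasureTheory _root_.Filter _root_.Complex _root_.Real _root_.Module _root_.Set
open scoped Topology FourierTransform RealInnerProductSpace ENNReal

namespace Literature.Probability.Distributions

section Kernel

variable {V : Type*} [NormedAddCommGroup V] [InnerProductSpace ℝ V]

/-! ## The heat kernel in Fourier normalisation -/

/-- The heat kernel in Fourier normalisation: `K_c(y) = (πc)^{d/2} e^{−π² c ‖y‖²}`, the Fourier
transform of `w ↦ e^{−‖w‖²/c}`; it has integral `1` and concentrates at `0` as `c → ∞`.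
[folklore] -/
def gaussKernel (c : ℝ) (y : V) : ℝ :=
  (π * c) ^ (finrank ℝ V / 2 : ℝ) * rexp (-π ^ 2 * c * ‖y‖ ^ 2)

/-- `K_c ≥ 0` for `c ≥ 0`. [folklore] -/
theorem gaussKernel_nonneg {c : ℝ} (hc : 0 ≤ c) (y : V) : 0 ≤ gaussKernel c y := by
  unfold gaussKernel; positivity

/-- `K_c` is continuous. [folklore] -/
theorem continuous_gaussKernel (c : ℝ) : Continuous (gaussKernel (V := V) c) := by
  unfold gaussKernel; fun_prop

/-- `K_c(y) ≤ K_c(0) = (πc)^{d/2}`. [folklore] -/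
theorem gaussKernel_le {c : ℝ} (hc : 0 ≤ c) (y : V) :
    gaussKernel c y ≤ (π * c) ^ (finrank ℝ V / 2 : ℝ) := by
  unfold gaussKernel
  have h1 : rexp (-π ^ 2 * c * ‖y‖ ^ 2) ≤ 1 := by
    rw [Real.exp_le_one_iff]
    have : 0 ≤ π ^ 2 * c * ‖y‖ ^ 2 := by positivity
    linarith
  have h0 : 0 ≤ (π * c) ^ (finrank ℝ V / 2 : ℝ) := by positivity
  nlinarith

/-- `K_c` is even: `K_c(x − y) = K_c(y − x)`. [folklore] -/
theorem gaussKernel_sub_comm (c : ℝ) (x y : V) :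
    gaussKernel c (x - y) = gaussKernel c (y - x) := by
  simp [gaussKernel, norm_sub_rev]

/-- The complex form of the kernel, as produced by Mathlib's Gaussian Fourier transform.
[folklore] -/
theorem ofReal_gaussKernel {c : ℝ} (hc : 0 < c) (y : V) :
    (gaussKernel c y : ℂ) =
      (π * c : ℂ) ^ (finrank ℝ V / 2 : ℂ) * cexp (-π ^ 2 * c * ‖y‖ ^ 2) := by
  unfold gaussKernel
  push_cast
  rw [Complex.ofReal_cpow (by positivity)]
  push_cast
  ring_nf

variable [MeasurableSpace V] [BorelSpace V] [FiniteDimensional ℝ V]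

/-- `∫ K_c = 1` (Gaussian integral `∫ e^{−b‖y‖²} = (π/b)^{d/2}`). [folklore] -/
theorem integral_gaussKernel {c : ℝ} (hc : 0 < c) : ∫ y : V, gaussKernel c y = 1 := by
  unfold gaussKernel
  simp_rw [show ∀ y : V, -π ^ 2 * c * ‖y‖ ^ 2 = -(π ^ 2 * c) * ‖y‖ ^ 2 from fun y => by ring]
  rw [integral_const_mul, GaussianFourier.integral_rexp_neg_mul_sq_norm (by positivity),
    ← Real.mul_rpow (by positivity) (by positivity),
    show π * c * (π / (π ^ 2 * c)) = 1 by field_simp]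
  exact Real.one_rpow _

/-- `K_c` is integrable (`c > 0`). [folklore] -/
theorem integrable_gaussKernel {c : ℝ} (hc : 0 < c) : Integrable (gaussKernel (V := V) c) := by
  refine Integrable.of_integral_ne_zero ?_
  rw [integral_gaussKernel hc]; exact one_ne_zero

end Kernel

variable {V : Type*} [NormedAddCommGroup V] [InnerProductSpace ℝ V] [MeasurableSpace V]

/-! ## The Fourier transform of a finite measure -/

/-- The Fourier transform of a measure `μ` on a finite-dimensional real inner product space, in
Mathlib's normalisation: `μ̂(w) = ∫ e^{-2πi⟪x, w⟫} dμ(x)` — the `VectorFourier.fourierIntegral` of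
the constant function `1` against `μ`. [folklore] -/
def fourierMeasure (μ : Measure V) : V → ℂ :=
  VectorFourier.fourierIntegral 𝐞 μ (innerₗ V) (1 : V → ℂ)

/-- `μ̂(w) = ∫ 𝐞(−⟪x, w⟫) dμ(x)`. [folklore] -/
theorem fourierMeasure_apply (μ : Measure V) (w : V) :
    fourierMeasure μ w = ∫ x, (𝐞 (-⟪x, w⟫) : ℂ) ∂μ := by
  simp [fourierMeasure, VectorFourier.fourierIntegral, Circle.smul_def]

/-- `charFun μ t = μ̂(−t/(2π))`. [folklore] -/
theorem charFun_eq_fourierMeasure (μ : Measure V) (t : V) :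
    charFun μ t = fourierMeasure μ (-(2 * π)⁻¹ • t) :=
  charFun_eq_fourierIntegral' t

/-- `μ̂(w) = charFun μ (−2π w)`. [folklore] -/
theorem fourierMeasure_eq_charFun (μ : Measure V) (w : V) :
    fourierMeasure μ w = charFun μ (-(2 * π) • w) := by
  rw [charFun_eq_fourierMeasure, smul_smul, neg_mul_neg,
    inv_mul_cancel₀ (by positivity : (2 * π : ℝ) ≠ 0), one_smul]

variable {μ : Measure V}

/-- `‖μ̂(w)‖ ≤ μ(V)`. [folklore] -/
theorem norm_fourierMeasure_le (w : V) : ‖fourierMeasure μ w‖ ≤ μ.real univ := by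
  rw [fourierMeasure_eq_charFun]; exact norm_charFun_le _

variable [BorelSpace V]

/-- `μ̂` is continuous for a finite measure. [folklore] -/
theorem continuous_fourierMeasure [IsFiniteMeasure μ] : Continuous (fourierMeasure μ) :=
  VectorFourier.fourierIntegral_continuous Real.continuous_fourierChar
    (by exact continuous_inner) (integrable_const (1 : ℂ))

variable [FiniteDimensional ℝ V]

/-- Integrability of `charFun μ` (the hypothesis of the inversion theorem as probabilists state
it) is the same as integrability of `μ̂`. [folklore] -/
theorem integrable_charFun_iff :
    Integrable (charFun μ) ↔ Integrable (fourierMeasure μ) := by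
  have h : charFun μ = fun t => fourierMeasure μ ((-(2 * π)⁻¹ : ℝ) • t) := by
    funext t; exact charFun_eq_fourierMeasure μ t
  rw [h]
  exact integrable_comp_smul_iff volume (fourierMeasure μ)
    (neg_ne_zero.mpr (inv_ne_zero (by positivity)))

/-! ## Gaussian smoothing of the measure -/

/-- The Gaussian smoothing of a measure: `g_c(v) = ∫ K_c(v − x) dμ(x)`, i.e. the density of
`μ ∗ N(0, (2π²c)⁻¹ I)`. [folklore] -/
def gaussSmooth (μ : Measure V) (c : ℝ) (v : V) : ℝ :=
  ∫ x, gaussKernel c (v - x) ∂μ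

omit [BorelSpace V] [FiniteDimensional ℝ V] in
/-- `g_c ≥ 0`. [folklore] -/
theorem gaussSmooth_nonneg {c : ℝ} (hc : 0 ≤ c) (v : V) : 0 ≤ gaussSmooth μ c v :=
  integral_nonneg fun _ => gaussKernel_nonneg hc _

omit [MeasurableSpace V] [BorelSpace V] [FiniteDimensional ℝ V] in
/-- The translated kernel is bounded by `(πc)^{d/2}`. [folklore] -/
theorem norm_gaussKernel_sub_le {c : ℝ} (hc : 0 ≤ c) (v x : V) :
    ‖gaussKernel c (v - x)‖ ≤ (π * c) ^ (finrank ℝ V / 2 : ℝ) := by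
  rw [Real.norm_eq_abs, abs_of_nonneg (gaussKernel_nonneg hc _)]; exact gaussKernel_le hc _

omit [FiniteDimensional ℝ V] in
/-- `x ↦ K_c(v − x)` is `μ`-integrable for a finite measure. [folklore] -/
theorem integrable_gaussKernel_sub [IsFiniteMeasure μ] {c : ℝ} (hc : 0 ≤ c) (v : V) :
    Integrable (fun x => gaussKernel c (v - x)) μ :=
  Integrable.mono' (integrable_const ((π * c) ^ (finrank ℝ V / 2 : ℝ)))
    ((continuous_gaussKernel c).comp (continuous_const.sub continuous_id)).aestronglyMeasurable
    (Eventually.of_forall fun x => norm_gaussKernel_sub_le hc v x)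

omit [FiniteDimensional ℝ V] in
/-- `g_c` is continuous (dominated convergence). [folklore] -/
theorem continuous_gaussSmooth [IsFiniteMeasure μ] {c : ℝ} (hc : 0 ≤ c) :
    Continuous (gaussSmooth μ c) :=
  continuous_of_dominated (bound := fun _ => (π * c) ^ (finrank ℝ V / 2 : ℝ))
    (fun _ => ((continuous_gaussKernel c).comp
      (continuous_const.sub continuous_id)).aestronglyMeasurable)
    (fun v => Eventually.of_forall fun x => norm_gaussKernel_sub_le hc v x) (integrable_const _)
    (Eventually.of_forall fun _ => (continuous_gaussKernel c).comp
      (continuous_id.sub continuous_const))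

/-- `(v, x) ↦ K_c(v − x)` is integrable on `Lebesgue × μ` (Tonelli, `∫ K_c = 1`). [folklore] -/
theorem integrable_uncurry_gaussKernel [IsFiniteMeasure μ] {c : ℝ} (hc : 0 < c) :
    Integrable (Function.uncurry fun v x : V => gaussKernel c (v - x)) (volume.prod μ) := by
  have hmeas : AEStronglyMeasurable (Function.uncurry fun v x : V => gaussKernel c (v - x))
      (volume.prod μ) :=
    ((continuous_gaussKernel c).comp continuous_sub).aestronglyMeasurable
  refine (integrable_prod_iff' hmeas).2 ⟨Eventually.of_forall fun x => ?_, ?_⟩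
  · exact (integrable_gaussKernel hc).comp_sub_right x
  · have h1 : (fun x : V => ∫ v, ‖Function.uncurry (fun v x : V => gaussKernel c (v - x)) (v, x)‖)
        = fun _ => (1 : ℝ) := by
      funext x
      simp only [Function.uncurry_apply_pair]
      simp_rw [fun v => Real.norm_of_nonneg (gaussKernel_nonneg hc.le (v - x))]
      rw [integral_sub_right_eq_self (gaussKernel c) x]
      exact integral_gaussKernel hc
    rw [h1]; exact integrable_const _

/-- `∫ g_c = μ(V)`: smoothing preserves mass (Tonelli and `∫ K_c = 1`). [folklore] -/
theorem integral_gaussSmooth [IsFiniteMeasure μ] {c : ℝ} (hc : 0 < c) :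
    ∫ v, gaussSmooth μ c v = μ.real univ := by
  unfold gaussSmooth
  rw [integral_integral_swap (integrable_uncurry_gaussKernel hc)]
  have : ∀ x : V, ∫ v, gaussKernel c (v - x) = 1 := fun x => by
    rw [integral_sub_right_eq_self (gaussKernel c) x]; exact integral_gaussKernel hc
  simp [this]

/-! ## The key identity: Gaussian-damped Fourier inversion of `μ̂` is the smoothing of `μ` -/

/-- For `c > 0`: `∫ e^{−‖w‖²/c + 2πi⟪v,w⟫} μ̂(w) dw = g_c(v)` (the multiplication formula
`∫ μ̂ · g = ∫ 𝓕g dμ` and the Fourier transform of the Gaussian). [folklore] -/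
theorem integral_cexp_mul_fourierMeasure [IsFiniteMeasure μ] {c : ℝ} (hc : 0 < c) (v : V) :
    ∫ w, cexp (-c⁻¹ * ‖w‖ ^ 2 + 2 * π * I * ⟪v, w⟫) * fourierMeasure μ w =
      (gaussSmooth μ c v : ℂ) := by
  have J : Integrable (fun w : V ↦ cexp (-c⁻¹ * ‖w‖ ^ 2 + 2 * π * I * ⟪v, w⟫)) :=
    GaussianFourier.integrable_cexp_neg_mul_sq_norm_add (by simpa using hc) _ _
  have hflip := VectorFourier.integral_fourierIntegral_smul_eq_flip (L := innerₗ V) (μ := μ)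
    (ν := volume) (f := (1 : V → ℂ)) Real.continuous_fourierChar continuous_inner
    (integrable_const (1 : ℂ)) J
  rw [flip_innerₗ] at hflip
  have h1 : ∫ w, cexp (-c⁻¹ * ‖w‖ ^ 2 + 2 * π * I * ⟪v, w⟫) * fourierMeasure μ w =
      ∫ w, fourierMeasure μ w • cexp (-c⁻¹ * ‖w‖ ^ 2 + 2 * π * I * ⟪v, w⟫) := by
    congr 1 with w; rw [smul_eq_mul, mul_comm]
  have h2 : ∀ x : V, VectorFourier.fourierIntegral 𝐞 volume (innerₗ V)
      (fun w : V ↦ cexp (-c⁻¹ * ‖w‖ ^ 2 + 2 * π * I * ⟪v, w⟫)) x = (gaussKernel c (v - x) : ℂ) := by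
    intro x
    have key := fourier_gaussian_innerProductSpace' (V := V) (b := ((c⁻¹ : ℝ) : ℂ))
      (by simpa using hc) v x
    rw [show VectorFourier.fourierIntegral 𝐞 volume (innerₗ V)
      (fun w : V ↦ cexp (-c⁻¹ * ‖w‖ ^ 2 + 2 * π * I * ⟪v, w⟫)) x =
      𝓕 (fun w : V ↦ cexp (-c⁻¹ * ‖w‖ ^ 2 + 2 * π * I * ⟪v, w⟫)) x from rfl, key,
      ofReal_gaussKernel hc, Complex.ofReal_inv, div_inv_eq_mul]
    congr 2
    rw [div_inv_eq_mul]; ring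
  rw [h1, fourierMeasure, hflip]
  simp only [Pi.one_apply, one_smul]
  simp_rw [h2]
  exact integral_ofReal

/-- `|g_c(v)| ≤ ‖μ̂‖_{L¹}` uniformly in `c > 0` (when `μ̂` is integrable). [folklore] -/
theorem gaussSmooth_le_integral_norm [IsFiniteMeasure μ] (hμ : Integrable (fourierMeasure μ))
    {c : ℝ} (hc : 0 < c) (v : V) :
    gaussSmooth μ c v ≤ ∫ w, ‖fourierMeasure μ w‖ := by
  have h := integral_cexp_mul_fourierMeasure (μ := μ) hc v
  have h1 : ‖(gaussSmooth μ c v : ℂ)‖ ≤ ∫ w, ‖fourierMeasure μ w‖ := by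
    rw [← h]
    refine (norm_integral_le_integral_norm _).trans
      (integral_mono_of_nonneg (Eventually.of_forall fun w => norm_nonneg _) hμ.norm
        (Eventually.of_forall fun w => ?_))
    dsimp only
    rw [norm_mul]
    have : ‖cexp (-c⁻¹ * ‖w‖ ^ 2 + 2 * π * I * ⟪v, w⟫)‖ ≤ 1 := by
      rw [Complex.norm_exp]
      have hre : (-c⁻¹ * ‖w‖ ^ 2 + 2 * π * I * ⟪v, w⟫ : ℂ).re = -c⁻¹ * ‖w‖ ^ 2 := by
        simp [Complex.add_re, Complex.mul_re, Complex.ofReal_re, Complex.ofReal_im,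
          ← Complex.ofReal_pow]
      rw [hre, Real.exp_le_one_iff]
      have : 0 ≤ c⁻¹ * ‖w‖ ^ 2 := by positivity
      linarith
    calc ‖cexp (-c⁻¹ * ‖w‖ ^ 2 + 2 * π * I * ⟪v, w⟫)‖ * ‖fourierMeasure μ w‖
        ≤ 1 * ‖fourierMeasure μ w‖ := by gcongr
      _ = ‖fourierMeasure μ w‖ := one_mul _
  rw [Complex.norm_real, Real.norm_eq_abs] at h1
  exact (le_abs_self _).trans h1

/-! ## The limit `c → ∞`: the candidate density -/

/-- **`g_c(v) → (𝓕⁻ μ̂)(v)` as `c → ∞`** when `μ̂` is integrable (dominated convergence on the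
Fourier side). [folklore] -/
theorem tendsto_gaussSmooth [IsFiniteMeasure μ] (hμ : Integrable (fourierMeasure μ)) (v : V) :
    Tendsto (fun c : ℝ => (gaussSmooth μ c v : ℂ)) atTop (𝓝 (𝓕⁻ (fourierMeasure μ) v)) := by
  have hint : Integrable (fun w : V ↦ 𝐞 ⟪w, v⟫ • fourierMeasure μ w) := by
    have B : Continuous fun p : V × V => (- innerₗ V) p.1 p.2 := continuous_inner.neg
    simpa using
      (VectorFourier.fourierIntegral_convergent_iff Real.continuous_fourierChar B v).2 hμ
  have A := Real.tendsto_integral_cexp_sq_smul hint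
  rw [← Real.fourierInv_eq] at A
  refine A.congr' ?_
  filter_upwards [Ioi_mem_atTop 0] with c (hc : 0 < c)
  rw [← integral_cexp_mul_fourierMeasure hc v]
  congr 1 with w
  rw [Circle.smul_def, Real.fourierChar_apply, smul_eq_mul, smul_eq_mul, ← mul_assoc,
    ← Complex.exp_add, real_inner_comm w]
  congr 2
  push_cast
  ring

/-- The set of complex numbers that are real and non-negative is closed. [folklore] -/
private theorem isClosed_ofReal_nonneg : IsClosed {z : ℂ | z.im = 0 ∧ 0 ≤ z.re} :=
  (isClosed_eq Complex.continuous_im continuous_const).inter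
    (isClosed_le continuous_const Complex.continuous_re)

/-- `(𝓕⁻ μ̂)(v)` is real and non-negative (a limit of the non-negative reals `g_c(v)`).
[folklore] -/
theorem fourierInv_fourierMeasure_im_eq_zero_and_re_nonneg [IsFiniteMeasure μ]
    (hμ : Integrable (fourierMeasure μ)) (v : V) :
    (𝓕⁻ (fourierMeasure μ) v).im = 0 ∧ 0 ≤ (𝓕⁻ (fourierMeasure μ) v).re := by
  have h := isClosed_ofReal_nonneg.mem_of_tendsto (tendsto_gaussSmooth hμ v)
    (Filter.eventually_atTop.2 ⟨1, fun c hc => ?_⟩)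
  · exact h
  · simp only [Set.mem_setOf_eq, Complex.ofReal_im, Complex.ofReal_re, true_and]
    exact gaussSmooth_nonneg (by linarith) v

/-- **The Fourier density of `μ`**: `f_μ(v) = Re (𝓕⁻ μ̂)(v) = Re ∫ e^{2πi⟪w,v⟫} μ̂(w) dw`
(equivalently `(2π)^{−d} ∫ e^{−i⟪t,v⟫} charFun μ (t) dt`); when `μ̂` is integrable this is a
continuous, non-negative, integrable function and `μ = f_μ · Lebesgue`
(`eq_withDensity_fourierDensity`). [folklore] -/
def fourierDensity (μ : Measure V) (v : V) : ℝ :=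
  (𝓕⁻ (fourierMeasure μ) v).re

/-- `f_μ(v)` IS the complex number `(𝓕⁻ μ̂)(v)` (which is real). [folklore] -/
theorem ofReal_fourierDensity [IsFiniteMeasure μ] (hμ : Integrable (fourierMeasure μ)) (v : V) :
    (fourierDensity μ v : ℂ) = 𝓕⁻ (fourierMeasure μ) v := by
  have h := fourierInv_fourierMeasure_im_eq_zero_and_re_nonneg hμ v
  exact Complex.ext (by simp [fourierDensity]) (by simp [h.1])

/-- `f_μ ≥ 0`. [folklore] -/
theorem fourierDensity_nonneg [IsFiniteMeasure μ] (hμ : Integrable (fourierMeasure μ)) (v : V) :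
    0 ≤ fourierDensity μ v :=
  (fourierInv_fourierMeasure_im_eq_zero_and_re_nonneg hμ v).2

/-- `f_μ` is continuous (`μ̂ ∈ L¹`). [folklore] -/
theorem continuous_fourierDensity (hμ : Integrable (fourierMeasure μ)) :
    Continuous (fourierDensity μ) := by
  have B : Continuous fun p : V × V => (- innerₗ V) p.1 p.2 := continuous_inner.neg
  exact Complex.continuous_re.comp
    (VectorFourier.fourierIntegral_continuous Real.continuous_fourierChar B hμ)

/-- `g_c(v) → f_μ(v)` as `c → ∞` (real form). [folklore] -/
theorem tendsto_gaussSmooth_fourierDensity [IsFiniteMeasure μ]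
    (hμ : Integrable (fourierMeasure μ)) (v : V) :
    Tendsto (fun c : ℝ => gaussSmooth μ c v) atTop (𝓝 (fourierDensity μ v)) := by
  have h := (Complex.continuous_re.tendsto _).comp (tendsto_gaussSmooth hμ v)
  simp only [Function.comp_def, Complex.ofReal_re] at h
  exact h

/-- `f_μ(v) ≤ ‖μ̂‖_{L¹}`. [folklore] -/
theorem fourierDensity_le_integral_norm [IsFiniteMeasure μ] (hμ : Integrable (fourierMeasure μ))
    (v : V) : fourierDensity μ v ≤ ∫ w, ‖fourierMeasure μ w‖ :=
  le_of_tendsto (tendsto_gaussSmooth_fourierDensity hμ v)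
    (Filter.eventually_atTop.2 ⟨1, fun c hc => gaussSmooth_le_integral_norm hμ (by linarith) v⟩)

/-! ## Integrability of the density (Fatou) -/

/-- `g_c` is Lebesgue-integrable. [folklore] -/
theorem integrable_gaussSmooth [IsFiniteMeasure μ] {c : ℝ} (hc : 0 < c) :
    Integrable (gaussSmooth μ c) :=
  (integrable_uncurry_gaussKernel hc).integral_prod_left

/-- **Fatou**: `∫ f_μ ≤ μ(V)` (as a lower Lebesgue integral), since `g_n → f_μ` pointwise
with `∫ g_n = μ(V)`. [folklore] -/
theorem lintegral_fourierDensity_le [IsFiniteMeasure μ] (hμ : Integrable (fourierMeasure μ)) :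
    ∫⁻ v, ENNReal.ofReal (fourierDensity μ v) ≤ μ univ := by
  -- Fatou along the sequence c = n + 1
  have hlim : ∀ v, Tendsto (fun n : ℕ => ENNReal.ofReal (gaussSmooth μ ((n : ℝ) + 1) v)) atTop
      (𝓝 (ENNReal.ofReal (fourierDensity μ v))) := fun v =>
    (ENNReal.continuous_ofReal.tendsto _).comp ((tendsto_gaussSmooth_fourierDensity hμ v).comp
      (tendsto_natCast_atTop_atTop.atTop_add tendsto_const_nhds))
  have hmeas : ∀ n : ℕ, Measurable fun v => ENNReal.ofReal (gaussSmooth μ ((n : ℝ) + 1) v) :=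
    fun n => ENNReal.measurable_ofReal.comp (continuous_gaussSmooth (by positivity)).measurable
  have hint : ∀ n : ℕ, ∫⁻ v, ENNReal.ofReal (gaussSmooth μ ((n : ℝ) + 1) v) = μ univ := fun n => by
    rw [← ofReal_integral_eq_lintegral_ofReal (integrable_gaussSmooth (by positivity))
      (Eventually.of_forall fun v => gaussSmooth_nonneg (by positivity) v),
      integral_gaussSmooth (by positivity), Measure.real,
      ENNReal.ofReal_toReal (measure_ne_top _ _)]
  calc ∫⁻ v, ENNReal.ofReal (fourierDensity μ v)
      = ∫⁻ v, liminf (fun n : ℕ => ENNReal.ofReal (gaussSmooth μ ((n : ℝ) + 1) v)) atTop := by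
        refine lintegral_congr fun v => ?_; rw [(hlim v).liminf_eq]
    _ ≤ liminf (fun n : ℕ => ∫⁻ v, ENNReal.ofReal (gaussSmooth μ ((n : ℝ) + 1) v)) atTop :=
        lintegral_liminf_le hmeas
    _ = μ univ := by simp [hint]

/-- `f_μ` is integrable. [folklore] -/
theorem integrable_fourierDensity [IsFiniteMeasure μ] (hμ : Integrable (fourierMeasure μ)) :
    Integrable (fourierDensity μ) := by
  refine ⟨(continuous_fourierDensity hμ).aestronglyMeasurable, ?_⟩
  rw [hasFiniteIntegral_iff_ofReal (Eventually.of_forall (fourierDensity_nonneg hμ))]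
  exact (lintegral_fourierDensity_le hμ).trans_lt (measure_lt_top _ _)


end Literature.Probability.Distributions

end
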